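import Mathlib.Analysis.Calculus.Deriv.Shift
import Literature.Analysis.FluidPDE.CompressibleEulerImplosion
import Literature.Analysis.FunctionSpaces.TorusCalculusProofs
import Literature.Analysis.FunctionSpaces.TorusSpaceTime

/-!
# Time reversal of classical isentropic Euler solutions on `𝕋³`

Helper file for the support item `TypeOneIdealImplosion` (stmt-AtomisticToContinuum-15146) of the
route `ImplosionDichotomy` (`AtomisticToContinuum/HydrodynamicLimit`). In the proof of that item the
smooth self-similar implosion of the monatomic gas on `ℝ³` (Buckmaster–Cao-Labora–Gómez-Serrano;
tree: `Literature.Analysis.FluidPDE.CaolaboraEtAl2025.exactSolution_of_profile`) is transplanted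
to the torus by finite speed of propagation (Cao-Labora–Gómez-Serrano–Shi–Staffilani, Rem. 1.5),
the EXTERIOR part of the periodic solution being obtained by solving the compressible Euler
equations BACKWARD in time from the explicit terminal far-field state. Backward solutions are
forward solutions of the time-reversed system, and the compressible Euler equations are
reversible: `(ρ, u)(t, x) ↦ (ρ, −u)(T − t, x)` maps classical solutions to classical solutions.
This file proves that symmetry for the tree's notion
`Literature.Analysis.FluidPDE.IsIsentropicEulerSolution γ` (jointly smooth `(ρ, u)` on
`[0, T) × 𝕋³`, `ρ > 0`, one-sided time derivative within `[0, T)`, mass + non-conservative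
momentum equation in the torus calculus):

* `IsIsentropicEulerSolution.reverse` — if `(ρ, u)` is a classical isentropic solution on
  `[0, T_b)` and `0 < T < T_b`, then `(t, x) ↦ (ρ(T − t, x), −u(T − t, x))` is a classical
  isentropic solution on `[0, T)`.

Everything is folklore bookkeeping: the reversed times `T − t`, `t ∈ [0, T)`, lie in the open
interval `(0, T_b)` where one-sided and two-sided time derivatives agree; `∂ₜ[ρ(T − t)] = −∂ₜρ`,
`∂ₜ[−u(T − t)] = +∂ₜu`, `div(ρ · (−u)) = −div(ρu)`, `∑ᵢ(−uᵢ)∂ᵢ(−u) = ∑ᵢuᵢ∂ᵢu`.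
-/

noncomputable section

namespace Summit.AtomisticToContinuum.HydrodynamicLimit.Theorems

open Set Filter Topology
open scoped ContDiff
open Literature.MathematicalPhysics.KineticTheory
open Literature.Analysis.FunctionSpaces Literature.Analysis.FunctionSpaces.Torus
open Literature.Analysis.FluidPDE (IsIsentropicEulerSolution)

/-! ## Pointwise torus calculus of negatives -/

/-- `∂ᵢ(−f)(x) = −∂ᵢf(x)` on the torus, for any `f`. [folklore] -/
theorem partialDeriv_neg_pt {F : Type*} [NormedAddCommGroup F] [NormedSpace ℝ F]
    (f : T3 → F) (i : Fin 3) (x : T3) :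
    partialDeriv i (fun y => -f y) x = -partialDeriv i f x := by
  simp only [partialDeriv, Torus.lineDeriv]
  exact deriv.fun_neg

/-- `div(−w)(x) = −div w(x)` on the torus, for any vector field `w`. [folklore] -/
theorem divergence_neg_pt (w : T3 → V3) (x : T3) :
    divergence (fun y => -w y) x = -divergence w x := by
  simp only [divergence]
  rw [← Finset.sum_neg_distrib]
  refine Finset.sum_congr rfl fun i _ => ?_
  have h := partialDeriv_neg_pt (fun y => w y i) i x
  simpa only [PiLp.neg_apply] using h

/-! ## Time reversal on `[0, T)` -/

section Reverse

variable {T Tb : ℝ}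

/-- For `t ∈ [0, T)` and `T < T_b`, the reversed time `T − t` lies in `(0, T_b)`. [folklore] -/
theorem sub_mem_Ioo_of_mem_Ico (hTb : T < Tb) {t : ℝ} (ht : t ∈ Ico 0 T) : T - t ∈ Ioo 0 Tb :=
  ⟨by linarith [ht.2], by linarith [ht.1]⟩

/-- Joint smoothness is preserved by time reversal: if `φ` is jointly smooth on `[0, T_b) × 𝕋³`
and `T < T_b` then `(t, x) ↦ φ(T − t, x)` is jointly smooth on `[0, T) × 𝕋³`. [folklore] -/
theorem isSmoothSpaceTimeOn_reverse {F : Type*} [NormedAddCommGroup F] [NormedSpace ℝ F]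
    {φ : ℝ → T3 → F} (hφ : IsSmoothSpaceTimeOn (Ico 0 Tb) φ) (hTb : T < Tb) :
    IsSmoothSpaceTimeOn (Ico 0 T) (fun t x => φ (T - t) x) := by
  have hmaps : MapsTo (fun p : ℝ × V3 => (T - p.1, p.2)) (Ico 0 T ×ˢ (univ : Set V3))
      (Ico 0 Tb ×ˢ (univ : Set V3)) := fun p hp =>
    ⟨Ioo_subset_Ico_self (sub_mem_Ioo_of_mem_Ico hTb hp.1), mem_univ _⟩
  have hg : ContDiff ℝ ∞ fun p : ℝ × V3 => (T - p.1, p.2) :=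
    (contDiff_const.sub contDiff_fst).prodMk contDiff_snd
  exact hφ.comp hg.contDiffOn hmaps

/-- **Time derivative of a reversed field.** For `φ` jointly smooth on `[0, T_b) × 𝕋³`, `T < T_b`
and `t ∈ [0, T)`: `∂ₜ[φ(T − ·)](t, x) = −∂ₜφ(T − t, x)` (one-sided derivatives within `[0, T)`,
resp. `[0, T_b)`; at the interior time `T − t ∈ (0, T_b)` both are two-sided). [folklore] -/
theorem timeDerivWithin_reverse {F : Type*} [NormedAddCommGroup F] [NormedSpace ℝ F]
    {φ : ℝ → T3 → F} (hφ : IsSmoothSpaceTimeOn (Ico 0 Tb) φ) (hTb : T < Tb) {t : ℝ}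
    (ht : t ∈ Ico 0 T) (x : T3) :
    timeDerivWithin (Ico 0 T) (fun s y => φ (T - s) y) t x =
      -timeDerivWithin (Ico 0 Tb) φ (T - t) x := by
  have hs := sub_mem_Ioo_of_mem_Ico hTb ht
  have hsI : T - t ∈ Ico 0 Tb := Ioo_subset_Ico_self hs
  -- two-sided derivative of the slice at the interior time `T - t`
  have h1 : HasDerivAt (fun τ => φ τ x) (timeDerivWithin (Ico 0 Tb) φ (T - t) x) (T - t) :=
    (hφ.hasDerivWithinAt_slice hsI x).hasDerivAt (Ico_mem_nhds hs.1 hs.2)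
  have h2 : HasDerivAt (fun τ => φ (T - τ) x) (-timeDerivWithin (Ico 0 Tb) φ (T - t) x) t :=
    h1.comp_const_sub T t
  exact h2.hasDerivWithinAt.derivWithin (uniqueDiffOn_Ico 0 T t ht)

/-- **Time reversal of classical isentropic Euler solutions on `𝕋³`.** If `(ρ, u)` is a
classical solution of the isentropic compressible Euler system with pressure `ρ^γ/γ` on
`[0, T_b) × 𝕋³` and `0 < T < T_b`, then `(t, x) ↦ (ρ(T − t, x), −u(T − t, x))` is a classical
solution on `[0, T) × 𝕋³`: the mass equation changes sign as a whole, the momentum equation is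
invariant (two sign changes in `ρ∂ₜu`, two in `ρ(u·∇)u`, none in `∇p`). [folklore] -/
theorem isIsentropicEulerSolution_reverse {γ : ℝ} {ρ : ℝ → T3 → ℝ} {u : ℝ → T3 → V3}
    (h : IsIsentropicEulerSolution γ Tb ρ u) (hTb : T < Tb) :
    IsIsentropicEulerSolution γ T (fun t x => ρ (T - t) x) (fun t x => -u (T - t) x) where
  smooth_density := isSmoothSpaceTimeOn_reverse h.smooth_density hTb
  smooth_velocity := (isSmoothSpaceTimeOn_reverse h.smooth_velocity hTb).neg
  density_pos t ht x := h.density_pos _ (Ioo_subset_Ico_self (sub_mem_Ioo_of_mem_Ico hTb ht)) x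
  mass t ht x := by
    have hsI : T - t ∈ Ico 0 Tb := Ioo_subset_Ico_self (sub_mem_Ioo_of_mem_Ico hTb ht)
    have hm := h.mass _ hsI x
    rw [timeDerivWithin_reverse h.smooth_density hTb ht x]
    have hdiv : divergence (fun y => ρ (T - t) y • -u (T - t) y) x =
        -divergence (fun y => ρ (T - t) y • u (T - t) y) x := by
      rw [← divergence_neg_pt]
      congr 1
      funext y
      rw [smul_neg]
    rw [hdiv]
    linear_combination (-1 : ℝ) * hm
  momentum t ht x := by
    have hsI : T - t ∈ Ico 0 Tb := Ioo_subset_Ico_self (sub_mem_Ioo_of_mem_Ico hTb ht)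
    have hm := h.momentum _ hsI x
    -- `∂ₜ[−u(T − ·)] = ∂ₜu(T − t)`
    have hneg : IsSmoothSpaceTimeOn (Ico 0 Tb) (fun s y => -u s y) := h.smooth_velocity.neg
    have ht1 : timeDerivWithin (Ico 0 T) (fun s y => -u (T - s) y) t x =
        timeDerivWithin (Ico 0 Tb) u (T - t) x := by
      rw [timeDerivWithin_reverse hneg hTb ht x]
      simp only [timeDerivWithin]
      rw [derivWithin.fun_neg, neg_neg]
    -- `∑ᵢ (−uᵢ) ∂ᵢ(−u) = ∑ᵢ uᵢ ∂ᵢu`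
    have ht2 : (∑ i, ((-u (T - t) x) i) • partialDeriv i (fun y => -u (T - t) y) x) =
        ∑ i, (u (T - t) x i) • partialDeriv i (u (T - t)) x := by
      refine Finset.sum_congr rfl fun i _ => ?_
      rw [partialDeriv_neg_pt, PiLp.neg_apply, smul_neg, neg_smul, neg_neg]
    rw [ht1, ht2]
    exact hm

end Reverse

end Summit.AtomisticToContinuum.HydrodynamicLimit.Theorems

end
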